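import Mathlib
import HarnessLib
import HarnessLib.Audit
import Summits.MatrixMultiplication.Statement
import Literature.Computability.AlgebraicComplexity.DivisionSLP
import Literature.Computability.AlgebraicComplexity.FlatteningBound
import HarnessLib.Audit.Status.Attr

/-!
Route: CondensationDistance

DORMANT since 2026-08-26T09:37:53Z (reconciler: no traction for 8.4 d (last activity item-evidence-added at 2026-08-17T23:10:03Z); parked, not closed — `ledger route dormant route-MatrixMultiplication-CondensationDistance --off` to reac) — unstaffed, not closed; items shared with open routes are served there. `ledger route dormant <id> --off` reactivates.

# Route CondensationDistance — omega = 2 if determinants condense in quadratic time — octahedral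
Plücker-closure distance in the Johnson scheme J(2n,n)

X (SHORT CONDENSATION): view every minor of a generic n × n matrix X (and of auxiliary generic
columns Y) as a Plücker coordinate P_J of
the n × (n+m') matrix [I_n | X | Y], J an n-subset of the column set. Start from the radius-1 ball
{J : #(J ∖ [n]) ≤ 1} (the entries and 1).
ONE STEP adds a coordinate P_J when, for some p ≠ q ∈ J and u ≠ v ∉ J, the five octahedron-mates
J−p+u, J−p+v, J−q+u, J−q+v, J−p−q+u+v are
known (the three-term Plücker relation then gives P_J = (±P·P ± P·P)/P). X: for every ε > 0 and all
large n, with m' ≤ n^c auxiliary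
columns, det X = P_{[n,2n)} is reached in ≤ n^(2+ε) steps. Dodgson/Bareiss condensation is the
monotone special case and costs
(n−1)n(2n−1)/6; X says the non-monotone (same-height / upward) Plücker moves shortcut the octahedron
light-cone. X ⇒ L^Ω(det_n) = n^(2+o(1))
⇒ ω = 2 (Baur–Strassen). No card is realised (new line). Cruxes (= the binders of `closes`): X
itself (rank 2) and the two unvendored bridge theorems CondensationSound (5), DerivationsBoundOmega
(6); the stronger TightCondensation and CheapHalfTransport are SUPPORT statements (sufficient
conditions feeding X through the glue supports TightToShort / TransportToTight — the registered line
Cruxes/ShortCondensation/Lines/birth.lean on X, whose engine stub is CheapHalfTransport verbatim),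
and the negative statement TightCubicBarrier is filed as the kill.
Lean: `∀ ε : ℝ, 0 < ε → ∃ c n₀ : ℕ, ∀ n ≥ n₀, ∃ m' : ℕ, n ≤ m' ∧ m' ≤ n ^ c ∧ ∃ (l : ℕ) (f : Fin l →
Finset (Fin (n + m'))), (l : ℝ) ≤ (n : ℝ) ^ (2 + ε) ∧ (∀ i : Fin l, ∃ p ∈ f i, ∃ q ∈ f i, p ≠ q ∧ ∃
u ∉ f i, ∃ v ∉ f i, u ≠ v ∧ ∀ J ∈ [insert u ((f i).erase p), insert v ((f i).erase p), insert u ((f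
i).erase q), insert v ((f i).erase q), insert u (insert v (((f i).erase p).erase q))], (J.card = n ∧
(J.filter fun x : Fin (n + m') => n ≤ x.val).card ≤ 1) ∨ ∃ j : Fin l, j < i ∧ f j = J) ∧ ∃ i : Fin
l, f i = Finset.univ.filter fun x : Fin (n + m') => n ≤ x.val ∧ x.val < 2 * n`

## Assembly
Pure logic plus the tree's lower bound `omega_two_le` (sorry-free `closes` in Sketch.lean /
glue.lean): fix ε > 0; ShortCondensation gives,
for all large n, m' ≥ n and a derivation of length l ≤ n^(2+ε); CondensationSound turns it into
`Derivable ℂ (5 l) (entries) {det X}`;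
DerivationsBoundOmega with τ = 2 + ε and C = 5 gives ω ≤ 2 + ε; ε → 0 and ω ≥ 2 give ω(ℂ) = 2 =
MatrixMultiplication. Every binder of `closes` is a crux
(crux-only rule) and every crux is a binder; the stronger support statements feed X:
TightCondensation → X (TightToShort), CheapHalfTransport → TightCondensation (TransportToTight) —
the line of attack on X registered as Cruxes/ShortCondensation/Lines/birth.lean; TightCubicBarrier
is the kill.

Rationale: WHY THIS LINE. Every open route attacks ω through tensors (degenerations, designs, hosts, spectra)
or through lower-bound technology; none uses the
classical equivalence ω = ω(Det) (BurgisserClausenShokrollahi1997 Thm (16.7), via the derivative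
inequality of BaurStrassen1983) as the
entry point, because "det_n in n^(2+o(1)) operations" is just as structureless as the summit. The
lever here is a RESTRICTED, purely
combinatorial model of determinant computation in which the only algebra is the fixed three-term
Plücker relation: a computation is a
reachability sequence in ONE explicit S_(2n)-symmetric 6-uniform hypergraph (the octahedra {S∪xy :
xy ⊂ abcd} of the Johnson scheme
J(2n,n)), and ω = 2 follows from a quadratic bound on the closure distance from the ball around [n]
to its antipode. Imported areas:
cluster / total-positivity combinatorics (BerensteinFominZelevinsky1996 chamber ansatz,
OhPostnikovSpeyer2011 weak separation and square
moves, Speyer2004 octahedron recurrence; FominGrigorievKoshevoy2014 use exactly these "Plücker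
transformations" as algorithm steps for
Schur functions), classical elimination (Dodgson1867, Bareiss1968 = the monotone derivations), and
algebraic complexity (BCS §7, §14–16 for
the bridge). What it does that prior routes / the negatives index do not: no tensor, no design, no
group — a shortest-path problem with a
huge symmetry group, searchable exactly for small n (SAT) and attackable by explicit derivation
design; its negation is a pebbling /
isoperimetric statement about J(2n,n), i.e. a NEW kind of barrier ("condensation is cubic") rather
than an instance of a catalogued one.

RANKED CRUXES. #2 ShortCondensation (crux) — X as in § Thesis: for every ε > 0 there are c, n₀ such
that for all n ≥ n₀ some m' with n ≤ m' ≤ n^c admits a valid Plücker derivation (each listed n-set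
justified by an octahedron whose other five vertices are in the ball or listed earlier) of length ≤
n^(2+ε) that lists the target {n ≤ x < 2n}. [difficulty: open-problem] (why it might fail: the
closure may be inherently cubic: monotone (Dodgson-type) derivations appear forced into the
(k+1)²-per-level triangle, exhaustive search gives D(4) = 14 = Dodgson, and auxiliary columns may
add nothing.) [Dodgson1867, Bareiss1968, FominGrigorievKoshevoy2014,
BurgisserClausenShokrollahi1997]
#5 CondensationSound (crux) — SOUNDNESS: a valid derivation of length l listing the target yields a
straight-line program with division of length ≤ 5·l over ℂ(Z) (Z = [X | Y] generic n × m') computing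
det X from the entries of Z: each step is the three-term Grassmann–Plücker relation among the six
maximal minors P_(S∪xy) of [I | Z] solved for one of them, P_J = (±P₁P₂ ± P₃P₄)·P₅⁻¹, the divisor
being a nonzero generic minor (tree model `Derivable`, BCS Def. (4.4)). [difficulty: M] (why it
might fail: classical but unvendored: Mathlib has no Grassmann–Plücker relations; signs for maximal
minors of [I|Z], generic non-vanishing of each divisor and the step count 5 (`DivStep` bookkeeping)
must all be right as typed, or `closes` breaks.) [BurgisserClausenShokrollahi1997,
FominGrigorievKoshevoy2014, BerensteinFominZelevinsky1996]
#6 DerivationsBoundOmega (crux) — LITERATURE BRIDGE (BCS 1997 Thm (16.7) "ω(Det) = ω", proof chain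
(16.2), Cor. (7.9) = Baur–Strassen derivative inequality, Thm (7.1) Vermeidung von Divisionen with d
= 2, (14.8), (15.1)): if det X_n is computable from the entries of [X | Y] (Y auxiliary
indeterminates, specialised to generic constants) by straight-line programs with division of length
≤ C·n^τ for all large n, then the tree's rank exponent satisfies omega ℂ ≤ τ. [difficulty: L] (why
it might fail: model transfer: BCS (16.7) is about c_*-length on def Π, the tree's `Derivable`
counts all Ω-steps in Frac(ℂ[Z]) and `omega` is the rank exponent; needs (7.1) (d = 2), (7.9) in the
Derivable model and generic specialisation of Y — standard, unvendored.)
[BurgisserClausenShokrollahi1997, BaurStrassen1983, Strassen1973, Blaser2013]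
#9 TightCondensation (support; crux #3 at open, re-kinded 2026-08-17: not a hypothesis of `closes`
but a stronger sufficient condition for X, reached through TightToShort) — the same with NO
auxiliary columns (m' = n): in the Johnson scheme J(2n,n) the octahedral closure distance D(n) from
the radius-1 ball around [n] to the complement [n,2n) is n^(2+o(1)) (Dodgson: D(n) ≤ (n−1)n(2n−1)/6;
fan-in: D(n) ≥ n²/4). [difficulty: open-problem] (why it might fail: D(4) = 14 (exhaustive) matches
Dodgson exactly; if D(5) = 30 and D(6) = 55 too, the natural conjecture is D(n) = (n−1)n(2n−1)/6 and
the statement is false (then TightCubicBarrier is the theorem to prove).) [Dodgson1867, Speyer2004,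
OhPostnikovSpeyer2011, FominGrigorievKoshevoy2014]
#9 CheapHalfTransport (support; crux #4 at open, re-kinded 2026-08-17: the engine stub
`stub_cheapHalfTransport` of the registered line Lines/birth.lean on X, staffed there) — FRAME
TRANSPORT: for every ε > 0 and all large n there is a valid derivation of length ≤ n^(2+ε) from the
ball around [n] after which the whole radius-1 ball around the core set H = {n/2 ≤ x < n + n/2} (det
of the leading (n/2)-block, its bordered minors and its row/column-substituted cores — the Bareiss
frame at stage n/2) is known; with the Sylvester sub-scheme recursion D(n) ≤ T(n) + D(⌈n/2⌉)
(support TransportToTight) this yields TightCondensation. [difficulty: XL] (why it might fail: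
moving the frame by unit Johnson steps renews ~n² sets per step (cost ~n³/2 to reach H); a transport
avoiding intermediate frames must derive n² far coordinates with n^(o(1)) amortised work each, and
no such scheme is known even heuristically.) [Bareiss1968, BerensteinFominZelevinsky1996,
OhPostnikovSpeyer2011]
#9 TightCubicBarrier (support) — NEGATIVE side (the kill criterion, filed for refuters/disprovers;
not on the implication path): there is c > 0 such that for every n ≥ 2 every valid derivation in
J(2n,n) that lists the complement [n,2n) has length ≥ c·n³ — octahedral closure cannot beat
condensation by more than a constant factor. Why it might be FALSE: only monotone (premises strictly
lower) derivations are controlled by the octahedron-recurrence light cone; same-height (Plücker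
exchange inside Gr(h,n)) and upward steps exist, and rectangle-coverage potentials provably give no
more than the trivial n²/4. [difficulty: L] [Speyer2004, Dodgson1867, FominGrigorievKoshevoy2014]
#9 TightToShort (support) — TightCondensation → ShortCondensation (take m' = n ≤ n^1, c = 1; the
targets coincide). [difficulty: provable-now] [Dodgson1867]
#9 TransportToTight (support) — CheapHalfTransport → TightCondensation: once the ball around H is
known, the n-sets containing the core columns [n, n+n/2) and avoiding the core rows [0, n/2) form a
copy of J(2n', n'), n' = n − n/2, with base H ↦ [n'] and the same target, whose initial ball lies in
the ball around H and whose octahedra are octahedra of J(2n,n); transport derivations along this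
embedding and recurse (D(n) ≤ T(n) + D(n'), geometric sum ≤ (log n)·n^(2+ε)). [difficulty: M]
[Bareiss1968, BurgisserClausenShokrollahi1997]

TWO-LAYER PLAN. Foreseen glued splits (nothing filed now; CheapHalfTransport is now worked as the
engine stub of the line on ShortCondensation, so its split would be a stub reshaping there):
CheapHalfTransport ⇐ CoreChain (det of the leading block with its 2k(n−k) substituted cores,
i.e. the height-k slice of the ball around H, in n^(2+ε)) → BorderedFill (the (n−k)² bordered minors
from the slice plus the ball around
[n], in n^(2+ε)) → CheapHalfTransport; TightCubicBarrier ⇐ MonotoneIsDodgson (derivations whose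
premises are strictly lower cost exactly
(n−1)n(2n−1)/6) → HorizontalNoGain (same-height / upward steps save at most a constant factor) →
TightCubicBarrier; DerivationsBoundOmega ⇐
DivisionDerivativeInequality (BCS (7.9) in the `Derivable` model) → InverseToMaMu (BCS (7.1), block
trick, (14.8)) → DerivationsBoundOmega.

KILL CRITERIA. TightCubicBarrier PROVED together with the same argument covering auxiliary generic
columns (any lower bound D(n, n^c) ≥ n^(2+δ)) refutes
ShortCondensation: close `refuted:ShortCondensation` and file the lower bound as a catalogue entry
Literature/Barriers/MatrixMultiplication/
CondensationBarrier (a structured-model lower bound for det). TightCubicBarrier alone refutes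
TightCondensation and CheapHalfTransport and
forces the pivot to the auxiliary-column / long-relation variant (k-term Grassmann–Plücker steps at
cost k). Exact values D(5) = 30 and
D(6) = 55 (SAT, compute/condense.py) would not refute but would downgrade the line to dormant unless
a sub-Dodgson derivation appears at
n ≤ 8. ω = 2 proved elsewhere moots the route; ω > 2 (BorderRankLowerBound side) refutes X via the
bridge.

NOT DECOMPOSED YET. The soundness algebra (three-term relations for maximal minors of [I|Z] in
Mathlib terms, generic nonvanishing of minors) and the BCS
bridge are cruxes only because `closes` consumes them unproved (crux-only rule) — known mathematics,
sizeable formalisation, not decomposed; the transport-of-derivations lemma along sub-scheme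
embeddings
(needed by TransportToTight); the k-term Plücker generalisation and the with-auxiliary-columns lower
bound; any use of weak separation /
plabic tilings to DESIGN derivations (layer-2 children of CheapHalfTransport once the n ≤ 7 data are
in).

CHEAPEST FALSIFIER. Exact small values against Dodgson's 1, 5, 14, 30, 55: D(4) = 14 confirmed by
exhaustive structured search this session
(compute/exact4.py, < 1 s: no derivation with ≤ 13 steps; the optimum found is the Dodgson
triangle); D(5) (≤ 30) and the height profile of
an optimal derivation by SAT (pysat/CaDiCaL layered encoding, kit job j018897, compute/condense.py)
— D(5) < 30 would exhibit the first
non-monotone saving, D(5) = 30 sharpens TightCubicBarrier to the conjecture D(n) = (n−1)n(2n−1)/6.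
Refuters: run condense.py with
JOB_NS=6, JOB_HCAP=12 (depth-capped) next.

NUMBERS. Dodgson/Bareiss: D(n) ≤ Σ_(k=1)^(n−1) k² = (n−1)n(2n−1)/6 (1, 5, 14, 30, 55, 91); fan-in
bound D(n) ≥ (n² − 1)/4; D(2) = 1, D(3) = 5, D(4) = 14
(this session). Step taxonomy by height h = #(J ∖ [n]) of the conclusion vs premises: monotone DJ (4
× (h−1), 1 × (h−2)), mixed (2 × h,
3 × (h−1)), horizontal (5 × h: Plücker exchange in Gr(h, n) at fixed row set, or dually), upward
(uses h+1 / h+2). Max known height rises by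
≤ 1 per step. Bridge constants: one step = 5 Ω-operations; C(MaMu_(n/2)) ≤ 3·L(det_n) + n² (BCS
(16.7) proof); R ≤ 2·L_ns (BCS (14.8)).
Items at open: 9 (5 cruxes, 3 supports incl. the negative TightCubicBarrier, 1 assembly); after the
unused-crux repair (2026-08-17): 3 cruxes = exactly the binders of `closes` (ShortCondensation,
CondensationSound, DerivationsBoundOmega), 5 supports (TightCondensation, CheapHalfTransport,
TightToShort, TransportToTight, TightCubicBarrier), 1 assembly.

DEFINITION REQUESTS. None needed to state the items (the closure rule is inlined over Finset (Fin
(n+m'))); a definition item `PlueckerDerivation` under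
Summits/MatrixMultiplication/MatrixMultiplication/Theorems would shorten every statement and is
welcome once a prover touches
CondensationSound. Cite facts wanted for the bridge: BCS Thm (7.1) (Vermeidung, d = 2) and Cor.
(7.9) in the `Derivable` model; BCS (14.8).

Novelty: Searches (2026-08-16): `lit search --hybrid "Dodgson condensation Plücker relations determinant
complexity"` (8 docs, none on derivation
length); `lit search --hybrid "square moves plabic graphs distance … mutation sequence length"` (6,
irrelevant); `lit search --source arxiv`
× 6 queries ("Plucker relations determinant algorithm", "cluster algebra mutation complexity",
"Laurent phenomenon algorithm", "shortest
sequence of three-term Plücker relations", "computing the determinant using Plücker relations",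
"octahedron recurrence complexity
determinant": 0–8 hits, none relevant); `lit search --source zbmath "Dodgson condensation"` (8:
Robbins, Zeilberger, Abeles, Schwartz —
identities/history, no complexity); `lit galaxy search "Dodgson condensation" --star all` (20 rows:
Kuo graphical condensation, textbooks);
`lit galaxy search "three-term Plücker relations" --star pdf` (3: positive tropical Grassmannian);
`lit read arxiv:1307.8425 --grep` (FGK:
Plücker transformations as subtraction-free steps for Schur functions, O(n³), no minimal-length
question); route files + 46 open / 127
closed cards of the summit grepped for Baur|Dodgson|Plücker|cluster|condensation|Bareiss|Sylvester
(only _closed/totally-positive-toy-model,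
a toy model declined as vacuous for ω, and the Andrews-type circuit bridges of
DeterminantalIdealExponent / HiddenToeplitzCorners).
Nearest prior art found: FominGrigorievKoshevoy2014 (doi:10.1007/s10208-014-9231-y; Plücker/cluster
transformations as algorithm ste  [refs: 10.1007/s10208-014-9231-y, 1307.8425, arxiv:1307.8425, doi:10.1007/s10208-014-9231-y, FominGrigorievKoshevoy2014, BerensteinFominZelevinsky1996, Bareiss1968, Speyer2004, BurgisserClausenShokrollahi1997]

Barriers (technique_class: determinant-complexity, plucker-closure): - technique_class: determinant-complexity, plucker-closure
- Literature.Barriers.MatrixMultiplication.UniversalMethodBarrier: does not apply — the algorithms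
produced are Baur–Strassen gradients of a det-program, not degenerations of Kronecker powers of a
fixed starting tensor (no CW_q, no monomial degeneration); the barrier's class (universal method
from a fixed tensor family) is never entered.
- Literature.Barriers.MatrixMultiplication.IrreversibilityBarrier: does not apply for the same
reason (no intermediate tensor whose irreversibility could cap ω).
- Literature.Barriers.MatrixMultiplication.TricoloredSumFreeBarrier: does not apply — no STPP /
group design; likewise QuasirandomBarrier, YoungSubgroupBarrier, NilpotentGroupBarrier,
NormalizerBarrier, BoundedRankFrameBarrier, EquivoluminousBarrier, GradedPacking, RectangularBarrier
(all design/host-side).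
- Literature.Barriers.MatrixMultiplication.LinearRankMethodBarrier: not a lower-bound route; the
negative crux TightCubicBarrier is a lower bound in a STRUCTURED model (pebbling-type), outside the
rank-method class. Honest caveat: no catalogued barrier bites, and no evidence beyond Dodgson
supports X either; the bet is that non-monotone Plücker moves shortcut the octahedron light-cone,
which only exhaustive data at n = 5, 6 and a transport construction can substantiate.
- Literature.Barriers.MatrixMultiplication.InfimumNotMinimumBarrier: respected — X is asymptotic (∀
ε, all large n), no single n certifies ω = 2.
- Negativ

History (route lifecycle, newest last):
- 2026-08-26T09:37:53Z · DORMANT — reconciler: no traction for 8.4 d (last activity item-evidence-added at 2026-08-17T23:10:03Z); parked, not closed — `ledger route dormant route-MatrixMultiplica (operator:999:904549)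

sub-problem: MatrixMultiplication · status: dormant · opened planner-plan-novel-MatrixMultiplication-MatrixM-c775de46-v2-g2-0 2026-08-16T16:56:39Z · rev 3 · ledger route-MatrixMultiplication-CondensationDistance
GENERATED by the gate from the ledger (D-0016/17). Provers cite these decls: `theorem foo : Summit.MatrixMultiplication.MatrixMultiplication.Theses.CondensationDistance.<Decl> := …` in Summits/MatrixMultiplication/MatrixMultiplication/Theorems/<Name>.lean.
-/

namespace Summit.MatrixMultiplication.MatrixMultiplication.Theses.CondensationDistance

open scoped BigOperators Topology Manifold Classical MeasureTheory ProbabilityTheory Matrix InnerProductSpace ComplexConjugate ContinuousMap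
open Filter Set Function TopologicalSpace MeasureTheory

attribute [summit_statement] _root_.MatrixMultiplication

/-- item stmt-MatrixMultiplication-15936 · crux · rank 2 · open · by planner
why it might fail: the closure may be inherently cubic: monotone (Dodgson-type) derivations appear forced into the (k+1)²-per-level triangle, exhaustive search gives D(4) = 14 = Dodgson, and auxiliary columns may add nothing.
sources: Dodgson1867, Bareiss1968, FominGrigorievKoshevoy2014, BurgisserClausenShokrollahi1997
[crux] X as in § Thesis: for every ε > 0 there are c, n₀ such that for all n ≥ n₀ some m' with n ≤
m' ≤ n^c admits a valid Plücker derivation (each listed n-set justified by an octahedron whose other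
five vertices are in the ball or listed earlier) of length ≤ n^(2+ε) that lists the target {n ≤ x <
2n}. [difficulty: open-problem] -/
@[route_item "route-MatrixMultiplication-CondensationDistance", crux]
def ShortCondensation : Prop :=
  ∀ ε : ℝ, 0 < ε → ∃ c n₀ : ℕ, ∀ n ≥ n₀, ∃ m' : ℕ, n ≤ m' ∧ m' ≤ n ^ c ∧ ∃ (l : ℕ) (f : Fin l → Finset (Fin (n + m'))), (l : ℝ) ≤ (n : ℝ) ^ (2 + ε) ∧ (∀ i : Fin l, ∃ p ∈ f i, ∃ q ∈ f i, p ≠ q ∧ ∃ u ∉ f i, ∃ v ∉ f i, u ≠ v ∧ ∀ J ∈ [insert u ((f i).erase p), insert v ((f i).erase p), insert u ((f i).erase q), insert v ((f i).erase q), insert u (insert v (((f i).erase p).erase q))], (J.card = n ∧ (J.filter fun x : Fin (n + m') => n ≤ x.val).card ≤ 1) ∨ ∃ j : Fin l, j < i ∧ f j = J) ∧ ∃ i : Fin l, f i = Finset.univ.filter fun x : Fin (n + m') => n ≤ x.val ∧ x.val < 2 * n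

/-- item stmt-MatrixMultiplication-15939 · crux · rank 5 · closed · proved by Summit.MatrixMultiplication.MatrixMultiplication.Theorems.CondensationSound.CondensationSound_of @ 9599ae64dcc5 (prover) · by planner
why it might fail: classical but unvendored: Mathlib has no Grassmann–Plücker relations; signs for maximal minors of [I|Z], generic non-vanishing of each divisor and the step count 5 (`DivStep` bookkeeping) must all be right as typed, or `closes` breaks.
sources: BurgisserClausenShokrollahi1997, FominGrigorievKoshevoy2014, BerensteinFominZelevinsky1996
[crux] SOUNDNESS: a valid derivation of length l listing the target yields a straight-line program
with division of length ≤ 5·l over ℂ(Z) (Z = [X | Y] generic n × m') computing det X from the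
entries of Z: each step is the three-term Grassmann–Plücker relation among the six maximal minors
P_(S∪xy) of [I | Z] solved for one of them, P_J = (±P₁P₂ ± P₃P₄)·P₅⁻¹, the divisor being a nonzero
generic minor (tree model `Derivable`, BCS Def. (4.4)). [difficulty: M] -/
@[route_item "route-MatrixMultiplication-CondensationDistance", crux]
def CondensationSound : Prop :=
  ∀ (n m' : ℕ) (h : n ≤ m') (l : ℕ) (f : Fin l → Finset (Fin (n + m'))), (∀ i : Fin l, ∃ p ∈ f i, ∃ q ∈ f i, p ≠ q ∧ ∃ u ∉ f i, ∃ v ∉ f i, u ≠ v ∧ ∀ J ∈ [insert u ((f i).erase p), insert v ((f i).erase p), insert u ((f i).erase q), insert v ((f i).erase q), insert u (insert v (((f i).erase p).erase q))], (J.card = n ∧ (J.filter fun x : Fin (n + m') => n ≤ x.val).card ≤ 1) ∨ ∃ j : Fin l, j < i ∧ f j = J) → (∃ i : Fin l, f i = Finset.univ.filter fun x : Fin (n + m') => n ≤ x.val ∧ x.val < 2 * n) → Literature.Computability.AlgebraicComplexity.Derivable ℂ (5 * l) (Set.range fun p : Fin n × Fin m' => algebraMap (MvPolynomial (Fin n ×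 Fin m') ℂ) (FractionRing (MvPolynomial (Fin n × Fin m') ℂ)) (MvPolynomial.X p)) {algebraMap (MvPolynomial (Fin n × Fin m') ℂ) (FractionRing (MvPolynomial (Fin n × Fin m') ℂ)) (Matrix.det (Matrix.of fun i j : Fin n => MvPolynomial.X (i, Fin.castLE h j)))}

-- `CondensationSound` holds: proved by `Summit.MatrixMultiplication.MatrixMultiplication.Theorems.CondensationSound.CondensationSound_of` @ 9599ae64dcc5 (its module imports this route file, so no `_holds` link can be stated here).

/-- item stmt-MatrixMultiplication-15940 · crux · rank 6 · closed · proved by Summit.MatrixMultiplication.MatrixMultiplication.Theorems.DerivationsBoundOmega.DerivationsBoundOmega_of @ 91c486c4e96d (prover) · by planner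
why it might fail: model transfer: BCS (16.7) is about c_*-length on def Π, the tree's `Derivable` counts all Ω-steps in Frac(ℂ[Z]) and `omega` is the rank exponent; needs (7.1) (d = 2), (7.9) in the Derivable model and generic specialisation of Y — standard, unvendored.
sources: BurgisserClausenShokrollahi1997, BaurStrassen1983, Strassen1973, Blaser2013
[crux] LITERATURE BRIDGE (BCS 1997 Thm (16.7) "ω(Det) = ω", proof chain (16.2), Cor. (7.9) =
Baur–Strassen derivative inequality, Thm (7.1) Vermeidung von Divisionen with d = 2, (14.8),
(15.1)): if det X_n is computable from the entries of [X | Y] (Y auxiliary indeterminates,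
specialised to generic constants) by straight-line programs with division of length ≤ C·n^τ for all
large n, then the tree's rank exponent satisfies omega ℂ ≤ τ. [difficulty: L] -/
@[route_item "route-MatrixMultiplication-CondensationDistance", crux]
def DerivationsBoundOmega : Prop :=
  ∀ τ : ℝ, 2 ≤ τ → (∃ C : ℝ, ∃ n₀ : ℕ, ∀ n ≥ n₀, ∃ (m' : ℕ) (h : n ≤ m') (s : ℕ), (s : ℝ) ≤ C * (n : ℝ) ^ τ ∧ Literature.Computability.AlgebraicComplexity.Derivable ℂ s (Set.range fun p : Fin n × Fin m' => algebraMap (MvPolynomial (Fin n × Fin m') ℂ) (FractionRing (MvPolynomial (Fin n × Fin m') ℂ)) (MvPolynomial.X p)) {algebraMap (MvPolynomial (Fin n × Fin m') ℂ) (FractionRing (MvPolynomial (Fin n × Fin m') ℂ)) (Matrix.det (Matrix.of fun i j : Fin n => MvPolynomial.X (i, Fin.castLE h j)))}) → Literature.Computability.AlgebraicComplexity.omega ℂ ≤ τ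

-- `DerivationsBoundOmega` holds: proved by `Summit.MatrixMultiplication.MatrixMultiplication.Theorems.DerivationsBoundOmega.DerivationsBoundOmega_of` @ 91c486c4e96d (its module imports this route file, so no `_holds` link can be stated here).

/-- item stmt-MatrixMultiplication-15937 · support · rank 3 · open · by planner
why it might fail: D(4) = 14 (exhaustive) matches Dodgson exactly; if D(5) = 30 and D(6) = 55 too, the natural conjecture is D(n) = (n−1)n(2n−1)/6 and the statement is false (then TightCubicBarrier is the theorem to prove).
sources: Dodgson1867, Speyer2004, OhPostnikovSpeyer2011, FominGrigorievKoshevoy2014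
[crux] the same with NO auxiliary columns (m' = n): in the Johnson scheme J(2n,n) the octahedral
closure distance D(n) from the radius-1 ball around [n] to the complement [n,2n) is n^(2+o(1))
(Dodgson: D(n) ≤ (n−1)n(2n−1)/6; fan-in: D(n) ≥ n²/4). [difficulty: open-problem] -/
@[route_item "route-MatrixMultiplication-CondensationDistance"]
def TightCondensation : Prop :=
  ∀ ε : ℝ, 0 < ε → ∃ n₀ : ℕ, ∀ n ≥ n₀, ∃ (l : ℕ) (f : Fin l → Finset (Fin (n + n))), (l : ℝ) ≤ (n : ℝ) ^ (2 + ε) ∧ (∀ i : Fin l, ∃ p ∈ f i, ∃ q ∈ f i, p ≠ q ∧ ∃ u ∉ f i, ∃ v ∉ f i, u ≠ v ∧ ∀ J ∈ [insert u ((f i).erase p), insert v ((f i).erase p), insert u ((f i).erase q), insert v ((f i).erase q), insert u (insert v (((f i).erase p).erase q))], (J.card = n ∧ (J.filter fun x : Fin (n + n) => n ≤ x.val).card ≤ 1) ∨ ∃ j : Fin l, j < i ∧ f j = J) ∧ ∃ i : Fin l, f i = Finset.univ.filter fun x : Fin (n + n) => n ≤ x.val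

/-- item stmt-MatrixMultiplication-15938 · support · rank 4 · open · by planner
why it might fail: moving the frame by unit Johnson steps renews ~n² sets per step (cost ~n³/2 to reach H); a transport avoiding intermediate frames must derive n² far coordinates with n^(o(1)) amortised work each, and no such scheme is known even heuristically.
sources: Bareiss1968, BerensteinFominZelevinsky1996, OhPostnikovSpeyer2011
[crux] FRAME TRANSPORT: for every ε > 0 and all large n there is a valid derivation of length ≤
n^(2+ε) from the ball around [n] after which the whole radius-1 ball around the core set H = {n/2 ≤
x < n + n/2} (det of the leading (n/2)-block, its bordered minors and its row/column-substituted
cores — the Bareiss frame at stage n/2) is known; with the Sylvester sub-scheme recursion D(n) ≤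
T(n) + D(⌈n/2⌉) (support TransportToTight) this yields TightCondensation. [difficulty: XL] -/
@[route_item "route-MatrixMultiplication-CondensationDistance"]
def CheapHalfTransport : Prop :=
  ∀ ε : ℝ, 0 < ε → ∃ n₀ : ℕ, ∀ n ≥ n₀, ∃ (l : ℕ) (f : Fin l → Finset (Fin (n + n))), (l : ℝ) ≤ (n : ℝ) ^ (2 + ε) ∧ (∀ i : Fin l, ∃ p ∈ f i, ∃ q ∈ f i, p ≠ q ∧ ∃ u ∉ f i, ∃ v ∉ f i, u ≠ v ∧ ∀ J ∈ [insert u ((f i).erase p), insert v ((f i).erase p), insert u ((f i).erase q), insert v ((f i).erase q), insert u (insert v (((f i).erase p).erase q))], (J.card = n ∧ (J.filter fun x : Fin (n + n) => n ≤ x.val).card ≤ 1) ∨ ∃ j : Fin l, j < i ∧ f j = J) ∧ ∀ J : Finset (Fin (n + n)), J.card = n → (J \ (Finset.univ.filter fun x : Fin (n + n) => n / 2 ≤ x.val ∧ x.val < n + n / 2)).card ≤ 1 → (J.card = n ∧ (J.filter fun x : Fin (n + n) => n ≤ x.val).card ≤ 1) ∨ ∃ i : Fin l, f i = J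

/-- item stmt-MatrixMultiplication-15941 · support · rank 9 · open · by planner
sources: Speyer2004, Dodgson1867, FominGrigorievKoshevoy2014
[support] NEGATIVE side (the kill criterion, filed for refuters/disprovers; not on the implication
path): there is c > 0 such that for every n ≥ 2 every valid derivation in J(2n,n) that lists the
complement [n,2n) has length ≥ c·n³ — octahedral closure cannot beat condensation by more than a
constant factor. Why it might be FALSE: only monotone (premises strictly lower) derivations are
controlled by the octahedron-recurrence light cone; same-height (Plücker exchange inside Gr(h,n))
and upward steps exist, and rectangle-coverage potentials provably give no more than the trivial
n²/4. [difficulty: L] -/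
@[route_item "route-MatrixMultiplication-CondensationDistance"]
def TightCubicBarrier : Prop :=
  ∃ c : ℝ, 0 < c ∧ ∀ n ≥ 2, ∀ (l : ℕ) (f : Fin l → Finset (Fin (n + n))), (∀ i : Fin l, ∃ p ∈ f i, ∃ q ∈ f i, p ≠ q ∧ ∃ u ∉ f i, ∃ v ∉ f i, u ≠ v ∧ ∀ J ∈ [insert u ((f i).erase p), insert v ((f i).erase p), insert u ((f i).erase q), insert v ((f i).erase q), insert u (insert v (((f i).erase p).erase q))], (J.card = n ∧ (J.filter fun x : Fin (n + n) => n ≤ x.val).card ≤ 1) ∨ ∃ j : Fin l, j < i ∧ f j = J) → (∃ i : Fin l, f i = Finset.univ.filter fun x : Fin (n + n) => n ≤ x.val) → c * (n : ℝ) ^ (3 : ℕ) ≤ (l : ℝ)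

/-- item stmt-MatrixMultiplication-15942 · support · rank 9 · closed · proved by Summit.MatrixMultiplication.MatrixMultiplication.Theorems.ShortCondensation.TightToShort_proof @ 43e2f8b80425 (prover) · by planner
sources: Dodgson1867
[support] TightCondensation → ShortCondensation (take m' = n ≤ n^1, c = 1; the targets coincide).
[difficulty: provable-now] -/
@[route_item "route-MatrixMultiplication-CondensationDistance"]
def TightToShort : Prop :=
  TightCondensation → ShortCondensation

-- `TightToShort` holds: proved by `Summit.MatrixMultiplication.MatrixMultiplication.Theorems.ShortCondensation.TightToShort_proof` @ 43e2f8b80425 (its module imports this route file, so no `_holds` link can be stated here).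

/-- item stmt-MatrixMultiplication-15943 · support · rank 9 · closed · proved by Summit.MatrixMultiplication.MatrixMultiplication.Theorems.ShortCondensation.TransportToTight_proof @ 1a6b49f4b57c (prover) · by planner
sources: Bareiss1968, BurgisserClausenShokrollahi1997
[support] CheapHalfTransport → TightCondensation: once the ball around H is known, the n-sets
containing the core columns [n, n+n/2) and avoiding the core rows [0, n/2) form a copy of J(2n',
n'), n' = n − n/2, with base H ↦ [n'] and the same target, whose initial ball lies in the ball
around H and whose octahedra are octahedra of J(2n,n); transport derivations along this embedding
and recurse (D(n) ≤ T(n) + D(n'), geometric sum ≤ (log n)·n^(2+ε)). [difficulty: M] -/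
@[route_item "route-MatrixMultiplication-CondensationDistance"]
def TransportToTight : Prop :=
  CheapHalfTransport → TightCondensation

-- `TransportToTight` holds: proved by `Summit.MatrixMultiplication.MatrixMultiplication.Theorems.ShortCondensation.TransportToTight_proof` @ 1a6b49f4b57c (its module imports this route file, so no `_holds` link can be stated here).

/-- item stmt-MatrixMultiplication-15944 · assembly · rank 1 · open · by planner
sources: BurgisserClausenShokrollahi1997, BaurStrassen1983
[assembly] ShortCondensation → CondensationSound → DerivationsBoundOmega → MatrixMultiplication. -/
@[route_item "route-MatrixMultiplication-CondensationDistance"]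
def Assembly : Prop :=
  ShortCondensation → CondensationSound → DerivationsBoundOmega → _root_.MatrixMultiplication

/-! D-0027 §2.1 — DECIDING THEOREM (planner-authored via `route open/edit --closes-file`; by planner-plan-novel-MatrixMultiplication-MatrixM-c775de46-v2- 2026-08-16T16:56:39Z):
its hypotheses are this route's items and its conclusion the sub-problem Statement (glue_lint), and it elaborates with this file. -/

@[closes "route-MatrixMultiplication-CondensationDistance"] theorem closes (hX : ShortCondensation) (hS : CondensationSound) (hB : DerivationsBoundOmega) :
    _root_.MatrixMultiplication := by
  rw [MatrixMultiplication_iff]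
  refine le_antisymm ?_ (Literature.Computability.AlgebraicComplexity.omega_two_le ℂ)
  refine le_of_forall_pos_le_add fun ε hε => ?_
  refine hB (2 + ε) (by linarith) ?_
  obtain ⟨c, n₀, h⟩ := hX ε hε
  refine ⟨5, n₀, fun n hn => ?_⟩
  obtain ⟨m', hnm, -, l, f, hl, hvalid, hhit⟩ := h n hn
  refine ⟨m', hnm, 5 * l, ?_, hS n m' hnm l f hvalid hhit⟩
  push_cast
  nlinarith [hl]

end Summit.MatrixMultiplication.MatrixMultiplication.Theses.CondensationDistance
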